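import Literature.Probability.RandomPlanarGeometry.SAWCountZdThirdCoefficient
import Literature.Probability.RandomPlanarGeometry.SAWCountStepWords
import HarnessLib

/-!
# Non-self-avoiding memory-2 walks at small axis deficiency: loop lengths, the unit square, and the classes as word counts

Topic `Literature/Probability/RandomPlanarGeometry` (uses `SAWCountZdTopCoefficients.lean`: the loop lemma `two_mul_card_image_le_of_loop` and the
axis classes `G_n(u)` of non-self-avoiding memory-2 walks of `ℤ^u` using every axis; `SAWCountZdThirdCoefficient.lean`; `SAWFiniteMemoryFour.lean`:
the parity lemma `MemFour.walk_ne_of_odd`; `SAWFiniteMemoryLimit.lean`: `walks`, `memWalks`, `IsMemory`; `SAWCountStepWords.lean` /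
`Percolation.DualContours`: step words `w : Fin n → Fin d × Bool`, `wordPos`, `stepVec`, `wordPos_injective`).

PRINTED CONTEXT (locators only; nothing is quoted digit-for-digit). Madras–Slade (1993) §1.1 p. 3 (`c₄ = 2d(2d−1)³ − 2d(2d−2)`: the unit squares)
and §1.2 p. 10 (memory-2 walks). NOT IN PRINT (lane statements): the lemmas below — the first structural step of the lane's census law (L1)
(`DESIGN-ZD-CENSUS-LAW-L1.md`: the non-self-avoiding memory-2 walks of length `n` on `ℤ^{n−3}` using every axis fall into five loop-signature
classes `(4)`, `(4,4)`, `(4,6)`, `(6)` with counts `4(n−4)² + (n−5)²(n−3)`, `n−4`, `n−5`, `4(n−5)` — to be proved by the heir; the target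
`G_n(n−3) = (n−3)!·2^{n−3}(n³−9n²+29n−40)` feeds `SAWPulledLargeForceExpansionZdFourthSymbolCensus.exists_polynomial_count_topFour_of_card_badClass`).

THIS FILE (lane «pcv-sawmu», a-p1 g20; all PROVED, standard axioms, NO definitions):
* `exists_steps_axis` (the axis function of a walk), ★ `dim_le_card_image_add_of_steps` — THE AXIS BUDGET OF A WINDOW: `D ≤ #(axes stepped
  on in [i, j)) + (n − (j − i))` for a walk stepping on every axis;
* ★★ `two_mul_dim_add_loop_le` — A LOOP OF LENGTH `ℓ` COSTS `ℓ/2` AXES: a walk of `ℤ^D` of length `n` stepping on every axis with a repeat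
  `ω i = ω j` (`i < j ≤ n`, not necessarily the first) has `2D + (j − i) ≤ 2n`;
* ★★ `sub_eq_four_of_repeat_deficiency_two` / ★★ `sub_eq_four_or_six_of_repeat_deficiency_three` — at axis deficiency two EVERY repeat is at
  distance `4`; at deficiency three every repeat is at distance `4` or `6` (memory `2` + parity + the loop cost);
* ★★ `exists_square_of_repeat_four` — a `4`-loop of a memory-2 walk IS a unit square: steps `+s e_a, +t e_b, −s e_a, −t e_b`, `a ≠ b`;
* `wordPos_mem_walks`, ★ `card_filter_walks_eq_card_filter_words` / `card_filter_memWalks_eq_card_filter_words` (walk classes as word counts: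
  `w ↦ wordPos w` is a bijection onto `walks d n`), `stepVec_add_eq_zero_iff_eq_rev`, ★ `isMemory_two_wordPos_iff` (memory 2 ⟺ no immediate
  reversal), ★ `allAxes_wordPos_iff` (every axis stepped on ⟺ every axis occurs as a letter), ★★ `card_badClass_eq_card_badWords` — THE BAD-WALK
  CLASS `G_n(u)` of `SAWCountZdTopCoefficients` / `…FourthSymbolCensus` IS A WORD COUNT: reversal-free words with two equal partial sums and every
  axis occurring — the form on which the lane's type calculus (`WordTypes.canon`, `card_filter_sameType`) acts (`G_n(u) = u! ×` canonical words).
[cite: MadrasSlade1993, §1.1 p. 3; §1.2 p. 10]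

Provenance: lane «pcv-sawmu», a-p1 g20 (2026-08-27).
-/

noncomputable section

open Finset
open scoped BigOperators
open Literature.Probability.LatticeModels
open Literature.Probability.RandomPlanarGeometry.SAW
open Literature.Probability.Percolation

namespace Literature.Probability.RandomPlanarGeometry.SAW.Zd

section LoopLength

variable {D n : ℕ}

/-- The steps of a walk are unit coordinate vectors `± e_j`. [cite: MadrasSlade1993, §1.1 (p. 1); lane plumbing] -/
private theorem dt_exists_step_single {ω : ℕ → Site D} (hω : ω ∈ walks D n) {k : ℕ} (hk : k < n) :
    ∃ j : Fin D, ∃ s : ℤ, (s = 1 ∨ s = -1) ∧ ω (k + 1) - ω k = Pi.single j s := by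
  obtain ⟨j, hj | hj⟩ := (zdGraph_adj_iff_sub _ _).1 ((mem_walks.1 hω).2.2 k hk)
  · exact ⟨j, 1, Or.inl rfl, hj⟩
  · refine ⟨j, -1, Or.inr rfl, ?_⟩
    rw [Pi.single_neg, ← hj, neg_sub]

/-- Each step of a walk changes exactly one coordinate, by `±1`. [cite: MadrasSlade1993, §1.1 (p. 1); lane plumbing] -/
private theorem dt_exists_axis {ω : ℕ → Site D} (hω : ω ∈ walks D n) {k : ℕ} (hk : k < n) :
    ∃ a : Fin D, (ω (k + 1) a - ω k a = 1 ∨ ω (k + 1) a - ω k a = -1) ∧ ∀ b, b ≠ a → ω (k + 1) b = ω k b := by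
  obtain ⟨j, s, hs, hjs⟩ := dt_exists_step_single hω hk
  refine ⟨j, ?_, fun b hb => ?_⟩
  · have h := congrFun hjs j
    rw [Pi.sub_apply, Pi.single_eq_same] at h
    rcases hs with rfl | rfl
    · exact Or.inl h
    · exact Or.inr h
  · have h := congrFun hjs b
    rw [Pi.sub_apply, Pi.single_eq_of_ne hb] at h
    exact sub_eq_zero.1 h

/-- A coordinate that is nonzero at some time was changed by an earlier step. [cite: MadrasSlade1993, §1.1 (p. 1); lane plumbing] -/
private theorem dt_exists_step_ne {ω : ℕ → Site D} (h0 : ω 0 = 0) {a : Fin D} {i : ℕ} (hi : ω i a ≠ 0) :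
    ∃ k < i, ω (k + 1) a ≠ ω k a := by
  induction i with
  | zero => exact absurd (by rw [h0]; rfl) hi
  | succ i ih =>
    by_cases h : ω (i + 1) a = ω i a
    · obtain ⟨k, hk, hne⟩ := ih (by rwa [h] at hi)
      exact ⟨k, by omega, hne⟩
    · exact ⟨i, by omega, h⟩

/-- ★ THE AXIS BUDGET OF A WINDOW: if `ax k` is the axis of step `k` of an `n`-step walk of `ℤ^D` that steps on every axis, then for every
window `[i, j)` the dimension is at most the number of axes stepped on inside the window plus the number of steps outside it:
`D ≤ #(ax '' [i, j)) + (n − (j − i))`. [cite: MadrasSlade1993, §1.1 (p. 3); lane lemma] -/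
theorem dim_le_card_image_add_of_steps {ω : ℕ → Site D} (hω : ω ∈ walks D n) (hall : ∀ a : Fin D, ∃ i ≤ n, ω i a ≠ (0 : ℤ))
    (ax : ℕ → Fin D) (hax : ∀ k, k < n → ∀ b, b ≠ ax k → ω (k + 1) b = ω k b) {i j : ℕ} (hjn : j ≤ n) :
    D ≤ ((Finset.Ico i j).image ax).card + (n - (j - i)) := by
  classical
  have h0 : ω 0 = 0 := (mem_walks.1 hω).1
  -- (1) every axis is stepped on
  have hcover : (Finset.univ : Finset (Fin D)) ⊆ (Finset.range n).image ax := by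
    intro a _
    obtain ⟨t, ht, hne⟩ := hall a
    obtain ⟨k, hk, hstep⟩ := dt_exists_step_ne h0 hne
    have hkn : k < n := by omega
    refine Finset.mem_image.2 ⟨k, Finset.mem_range.2 hkn, ?_⟩
    by_contra hka
    exact hstep (hax k hkn a (fun h => hka h.symm))
  have hD : D ≤ ((Finset.range n).image ax).card := by
    have := Finset.card_le_card hcover
    rwa [Finset.card_univ, Fintype.card_fin] at this
  -- (2) split `[0, n)` into the window `[i, j)` and the rest
  have hIco : Finset.Ico i j ⊆ Finset.range n := fun k hk => by
    rw [Finset.mem_Ico] at hk; rw [Finset.mem_range]; omega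
  have hsplit : ((Finset.range n).image ax).card ≤ ((Finset.Ico i j).image ax).card + (n - (j - i)) := by
    have hunion : (Finset.range n).image ax ⊆ (Finset.Ico i j).image ax ∪ (Finset.range n \ Finset.Ico i j).image ax := by
      intro a ha
      obtain ⟨k, hk, rfl⟩ := Finset.mem_image.1 ha
      by_cases hkI : k ∈ Finset.Ico i j
      · exact Finset.mem_union_left _ (Finset.mem_image_of_mem _ hkI)
      · exact Finset.mem_union_right _ (Finset.mem_image_of_mem _ (Finset.mem_sdiff.2 ⟨hk, hkI⟩))
    calc ((Finset.range n).image ax).card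
        ≤ ((Finset.Ico i j).image ax ∪ (Finset.range n \ Finset.Ico i j).image ax).card := Finset.card_le_card hunion
      _ ≤ ((Finset.Ico i j).image ax).card + ((Finset.range n \ Finset.Ico i j).image ax).card := Finset.card_union_le _ _
      _ ≤ ((Finset.Ico i j).image ax).card + (Finset.range n \ Finset.Ico i j).card :=
          Nat.add_le_add_left Finset.card_image_le _
      _ = ((Finset.Ico i j).image ax).card + (n - (j - i)) := by
          rw [Finset.card_sdiff_of_subset hIco, Finset.card_range, Nat.card_Ico]
  exact hD.trans hsplit

/-- Every walk has an axis function: `ax k` = the axis of step `k` (`k < n`). [cite: MadrasSlade1993, §1.1 (p. 1); lane plumbing] -/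
theorem exists_steps_axis {ω : ℕ → Site D} (hω : ω ∈ walks D n) (hn : 0 < n) :
    ∃ ax : ℕ → Fin D, ∀ k, k < n → (ω (k + 1) (ax k) - ω k (ax k) = 1 ∨ ω (k + 1) (ax k) - ω k (ax k) = -1) ∧
      ∀ b, b ≠ ax k → ω (k + 1) b = ω k b := by
  classical
  obtain ⟨a₀, -, -⟩ := dt_exists_axis hω hn
  have hch : ∀ k, k < n → ∃ a : Fin D, (ω (k + 1) a - ω k a = 1 ∨ ω (k + 1) a - ω k a = -1) ∧
      ∀ b, b ≠ a → ω (k + 1) b = ω k b := fun k hk => dt_exists_axis hω hk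
  refine ⟨fun k => if hk : k < n then Classical.choose (hch k hk) else a₀, fun k hk => ?_⟩
  simp only [dif_pos hk]
  exact Classical.choose_spec (hch k hk)

/-- ★★ A LOOP OF LENGTH `ℓ` COSTS `ℓ/2` AXES: if an `n`-step walk of `ℤ^D` that steps on every axis has a repeat `ω i = ω j`
(`i < j ≤ n`), then `2D + (j − i) ≤ 2n` — on `[i, j)` every stepped axis is stepped at least twice (`two_mul_card_image_le_of_loop`), so at
most `(j − i)/2 + (n − (j − i))` axes are stepped on (`dim_le_card_image_add_of_steps`). (The repeat need not be the first one;
`SAWCountZdThirdCoefficient`'s `two_mul_dim_add_le_of_repeat_memory` is the case `j − i ≥ τ + 1`.) [cite: MadrasSlade1993, §1.1 (p. 3); §1.2 (p. 10); lane lemma] -/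
theorem two_mul_dim_add_loop_le {ω : ℕ → Site D} (hω : ω ∈ walks D n) (hall : ∀ a : Fin D, ∃ i ≤ n, ω i a ≠ (0 : ℤ))
    {i j : ℕ} (hij : i < j) (hj : j ≤ n) (hloop : ω i = ω j) : 2 * D + (j - i) ≤ 2 * n := by
  classical
  obtain ⟨ax, hax⟩ := exists_steps_axis hω (by omega)
  have h1 := dim_le_card_image_add_of_steps hω hall ax (fun k hk => (hax k hk).2) (i := i) hj
  have hloop2 : 2 * ((Finset.Ico i j).image ax).card ≤ j - i :=
    two_mul_card_image_le_of_loop hω hij.le hj hloop ax fun k _ hk b hb => (hax k (by omega)).2 b hb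
  omega

/-- ★★ AT AXIS DEFICIENCY TWO EVERY REPEAT IS A UNIT SQUARE: a memory-2 walk of length `D + 2` on `ℤ^D` that steps on every axis has all
its repeats `ω i = ω j` (`i < j`) at distance exactly `j − i = 4`. [cite: MadrasSlade1993, §1.1 (p. 3); §1.2 (p. 10); lane theorem] -/
theorem sub_eq_four_of_repeat_deficiency_two {ω : ℕ → Site D} (hω : ω ∈ memWalks D 2 (D + 2))
    (hall : ∀ a : Fin D, ∃ i ≤ D + 2, ω i a ≠ (0 : ℤ)) {i j : ℕ} (hij : i < j) (hj : j ≤ D + 2) (hloop : ω i = ω j) :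
    j - i = 4 := by
  obtain ⟨hw, hmem⟩ := mem_memWalks.1 hω
  have h1 := two_mul_dim_add_loop_le hw hall hij hj hloop
  have h2 : i + 2 < j := by
    by_contra hlt
    exact hmem i j hj hij (by omega) hloop
  have h3 : (i + j) % 2 = 0 := by
    by_contra hodd
    exact MemFour.walk_ne_of_odd hw (by omega) hj (by omega) hloop
  omega

/-- ★★ AT AXIS DEFICIENCY THREE EVERY REPEAT IS A SQUARE OR A HEXAGON: a memory-2 walk of length `D + 3` on `ℤ^D` that steps on every
axis has all its repeats `ω i = ω j` (`i < j`) at distance `j − i ∈ {4, 6}` — the first structural step of the census law (L1) (lane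
DESIGN-ZD-CENSUS-LAW-L1: the five loop-signature classes `(4)`, `(4,4)`, `(4,6)`, `(6)`).
[cite: MadrasSlade1993, §1.1 (p. 3); §1.2 (p. 10); lane theorem] -/
theorem sub_eq_four_or_six_of_repeat_deficiency_three {ω : ℕ → Site D} (hω : ω ∈ memWalks D 2 (D + 3))
    (hall : ∀ a : Fin D, ∃ i ≤ D + 3, ω i a ≠ (0 : ℤ)) {i j : ℕ} (hij : i < j) (hj : j ≤ D + 3) (hloop : ω i = ω j) :
    j - i = 4 ∨ j - i = 6 := by
  obtain ⟨hw, hmem⟩ := mem_memWalks.1 hω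
  have h1 := two_mul_dim_add_loop_le hw hall hij hj hloop
  have h2 : i + 2 < j := by
    by_contra hlt
    exact hmem i j hj hij (by omega) hloop
  have h3 : (i + j) % 2 = 0 := by
    by_contra hodd
    exact MemFour.walk_ne_of_odd hw (by omega) hj (by omega) hloop
  omega


/-- ★★ A 4-LOOP OF A MEMORY-2 WALK IS A UNIT SQUARE: if `ω i = ω (i+4)` then the four steps are `+s e_a, +t e_b, −s e_a, −t e_b` with
`a ≠ b` (`s, t = ±1`). (Memory 2 forbids `ω k = ω (k+2)`; the coordinate sums of the four unit steps then force the pattern `a b a b`.)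
[cite: MadrasSlade1993, §1.1 (p. 3: the unit squares behind `c₄`); §1.2 (p. 10); lane theorem] -/
theorem exists_square_of_repeat_four {ω : ℕ → Site D} (hω : ω ∈ memWalks D 2 n) {i : ℕ} (hi : i + 4 ≤ n)
    (hloop : ω i = ω (i + 4)) :
    ∃ a b : Fin D, a ≠ b ∧ ∃ s t : ℤ, (s = 1 ∨ s = -1) ∧ (t = 1 ∨ t = -1) ∧
      ω (i + 1) - ω i = Pi.single a s ∧ ω (i + 2) - ω (i + 1) = Pi.single b t ∧
      ω (i + 3) - ω (i + 2) = Pi.single a (-s) ∧ ω (i + 4) - ω (i + 3) = Pi.single b (-t) := by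
  classical
  obtain ⟨hw, hmem⟩ := mem_memWalks.1 hω
  obtain ⟨a1, s1, hs1, h1⟩ := dt_exists_step_single hw (show i < n by omega)
  obtain ⟨a2, s2, hs2, h2⟩ := dt_exists_step_single hw (show i + 1 < n by omega)
  obtain ⟨a3, s3, hs3, h3⟩ := dt_exists_step_single hw (show i + 2 < n by omega)
  obtain ⟨a4, s4, hs4, h4⟩ := dt_exists_step_single hw (show i + 3 < n by omega)
  rw [show i + 1 + 1 = i + 2 by omega] at h2
  rw [show i + 2 + 1 = i + 3 by omega] at h3
  rw [show i + 3 + 1 = i + 4 by omega] at h4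
  -- the four steps sum to zero
  have e : Pi.single a1 s1 + Pi.single a2 s2 + Pi.single a3 s3 + Pi.single a4 s4 = (0 : Site D) := by
    have : (ω (i + 1) - ω i) + (ω (i + 2) - ω (i + 1)) + (ω (i + 3) - ω (i + 2)) + (ω (i + 4) - ω (i + 3)) =
        ω (i + 4) - ω i := by abel
    rw [h1, h2, h3, h4, ← hloop, sub_self] at this
    exact this
  have ec : ∀ c : Fin D, (if c = a1 then s1 else 0) + (if c = a2 then s2 else 0) + (if c = a3 then s3 else 0) +
      (if c = a4 then s4 else 0) = (0 : ℤ) := by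
    intro c
    have := congrFun e c
    simpa only [Pi.add_apply, Pi.single_apply, Pi.zero_apply] using this
  -- memory two: consecutive steps on the same axis have the same sign
  have key : ∀ {k : ℕ} {a a' : Fin D} {x x' : ℤ}, k + 2 ≤ n → (x = 1 ∨ x = -1) → (x' = 1 ∨ x' = -1) →
      ω (k + 1) - ω k = Pi.single a x → ω (k + 2) - ω (k + 1) = Pi.single a' x' → a' = a → x' = x := by
    intro k a a' x x' hk hx hx' hka hkb haa
    subst haa
    by_contra hne
    have hx'' : x' = -x := by rcases hx with rfl | rfl <;> rcases hx' with rfl | rfl <;> simp_all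
    apply hmem k (k + 2) hk (by omega) (by omega)
    have : ω (k + 2) = ω k + (ω (k + 1) - ω k) + (ω (k + 2) - ω (k + 1)) := by abel
    rw [this, hka, hkb, hx'', Pi.single_neg]
    abel
  have m12 : a2 = a1 → s2 = s1 := key (by omega) hs1 hs2 h1 h2
  have m23 : a3 = a2 → s3 = s2 := key (by omega) hs2 hs3 h2 h3
  have m34 : a4 = a3 → s4 = s3 := key (by omega) hs3 hs4 h3 h4
  -- the pattern is `a b a b`
  have hne12 : a2 ≠ a1 := by
    intro h12
    have hs := m12 h12
    have e1 := ec a1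
    rw [if_pos rfl, if_pos h12.symm] at e1
    by_cases h3' : a1 = a3
    · have := m23 (h3'.symm.trans h12.symm)
      rw [if_pos h3'] at e1
      split_ifs at e1 <;> rcases hs1 with rfl | rfl <;> omega
    · rw [if_neg h3'] at e1
      split_ifs at e1 <;> rcases hs1 with rfl | rfl <;> rcases hs4 with rfl | rfl <;> omega
  have h31 : a3 = a1 := by
    by_contra h31
    have e1 := ec a1
    rw [if_pos rfl, if_neg (fun h => hne12 h.symm), if_neg (fun h => h31 h.symm)] at e1
    by_cases h41 : a1 = a4
    · rw [if_pos h41] at e1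
      have e2 := ec a2
      rw [if_neg hne12, if_pos rfl, if_neg (show ¬ (a2 = a4) from fun h => hne12 (h.trans h41.symm))] at e2
      by_cases h23 : a2 = a3
      · have := m23 h23.symm
        rw [if_pos h23] at e2
        rcases hs2 with rfl | rfl <;> omega
      · rw [if_neg h23] at e2
        rcases hs2 with rfl | rfl <;> omega
    · rw [if_neg h41] at e1
      rcases hs1 with rfl | rfl <;> omega
  have hs31 : s3 = -s1 ∧ a4 ≠ a1 := by
    have e1 := ec a1
    rw [if_pos rfl, if_neg (fun h => hne12 h.symm), if_pos h31.symm] at e1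
    by_cases h41 : a1 = a4
    · have := m34 (h41.symm.trans h31.symm)
      rw [if_pos h41] at e1
      rcases hs1 with rfl | rfl <;> rcases hs3 with rfl | rfl <;> omega
    · rw [if_neg h41] at e1
      exact ⟨by omega, fun h => h41 h.symm⟩
  have h42 : a4 = a2 ∧ s4 = -s2 := by
    have e2 := ec a2
    rw [if_neg hne12, if_pos rfl, if_neg (fun h => hne12 (h.trans h31))] at e2
    by_cases h24 : a2 = a4
    · rw [if_pos h24] at e2
      exact ⟨h24.symm, by omega⟩
    · rw [if_neg h24] at e2
      rcases hs2 with rfl | rfl <;> omega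
  refine ⟨a1, a2, fun h => hne12 h.symm, s1, s2, hs1, hs2, h1, h2, ?_, ?_⟩
  · rw [h3, h31, hs31.1]
  · rw [h4, h42.1, h42.2]

end LoopLength

section WordBridge

variable {d n : ℕ}

/-- Every step word traces a nearest-neighbour walk: `wordPos w ∈ walks d n`. [cite: MadrasSlade1993, §1.1 (p. 1); lane plumbing] -/
theorem wordPos_mem_walks (w : Fin n → Fin d × Bool) : (wordPos w : ℕ → Site d) ∈ walks d n := by
  rw [mem_walks]
  refine ⟨wordPos_zero w, fun i hi => wordPos_of_le w hi, fun i hi => ?_⟩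
  rw [zdGraph_adj_iff_stepVec]
  exact ⟨w ⟨i, hi⟩, wordPos_succ w hi⟩

/-- Every nearest-neighbour walk from the origin is traced by a step word. [cite: MadrasSlade1993, §1.1 (p. 1); lane plumbing] -/
private theorem wb_exists_word {ω : ℕ → Site d} (hω : ω ∈ walks d n) : ∃ w : Fin n → Fin d × Bool, (wordPos w : ℕ → Site d) = ω := by
  obtain ⟨h0, hend, hadj⟩ := mem_walks.1 hω
  choose f hf using fun i : Fin n => (zdGraph_adj_iff_stepVec _ _).1 (hadj i i.2)
  have hk : ∀ k ≤ n, wordPos f k = ω k := by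
    intro k hk
    induction k with
    | zero => rw [wordPos_zero, h0]
    | succ k ih => rw [wordPos_succ f (show k < n by omega), ih (by omega), ← hf ⟨k, by omega⟩]
  refine ⟨f, funext fun k => ?_⟩
  rcases le_or_gt k n with h | h
  · exact hk k h
  · rw [wordPos_of_le f h.le, hk n le_rfl, hend k h.le]

/-- ★ WALK CLASSES AS WORD COUNTS: for every property `P` of vertex functions, the `n`-step walks of `ℤ^d` with `P` are equinumerous with
the step words `w ∈ ({1…d} × {±})ⁿ` whose trace `wordPos w` has `P` (`w ↦ wordPos w` is a bijection onto `walks d n`).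
[cite: MadrasSlade1993, §1.1 (p. 1); lane lemma] -/
theorem card_filter_walks_eq_card_filter_words (P : (ℕ → Site d) → Prop) [DecidablePred P] :
    ((walks d n).filter P).card = (Finset.univ.filter fun w : Fin n → Fin d × Bool => P (wordPos w)).card := by
  classical
  rw [← Finset.card_image_of_injOn (f := fun w : Fin n → Fin d × Bool => (wordPos w : ℕ → Site d))
    (fun w₁ _ w₂ _ h => wordPos_injective n h)]
  congr 1
  ext ω
  simp only [Finset.mem_filter, Finset.mem_image, Finset.mem_univ, true_and]
  constructor
  · rintro ⟨hω, hP⟩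
    obtain ⟨w, rfl⟩ := wb_exists_word hω
    exact ⟨w, hP, rfl⟩
  · rintro ⟨w, hP, rfl⟩
    exact ⟨wordPos_mem_walks w, hP⟩

open Classical in
/-- The same for memory-`τ` walks (`memWalks d τ n = (walks d n).filter (IsMemory τ n)`). [cite: MadrasSlade1993, §1.2 (p. 10); lane lemma] -/
theorem card_filter_memWalks_eq_card_filter_words (τ : ℕ) (P : (ℕ → Site d) → Prop) [DecidablePred P] :
    ((memWalks d τ n).filter P).card =
      (Finset.univ.filter fun w : Fin n → Fin d × Bool => IsMemory τ n (wordPos w) ∧ P (wordPos w)).card := by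
  unfold memWalks
  rw [Finset.filter_filter]
  exact card_filter_walks_eq_card_filter_words (fun ω => IsMemory τ n ω ∧ P ω)

/-! #### The three class predicates read on the word -/

/-- Two unit steps cancel iff they are opposite steps on the same axis. [cite: MadrasSlade1993, §1.2 (p. 10); lane plumbing] -/
theorem stepVec_add_eq_zero_iff_eq_rev (a b : Fin d × Bool) : stepVec a + stepVec b = 0 ↔ b = (a.1, !a.2) := by
  constructor
  · intro h
    obtain ⟨i, s⟩ := a
    obtain ⟨j, t⟩ := b
    have hi := congrFun h i
    simp only [Pi.add_apply, Pi.zero_apply] at hi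
    by_cases hij : j = i
    · subst hij
      have hts : t ≠ s := by
        rintro rfl
        cases t <;> simp [stepVec] at hi
      cases s <;> cases t <;> simp_all
    · exfalso
      have hj0 : stepVec (j, t) i = 0 := by
        cases t <;> simp [stepVec, Pi.single_eq_of_ne (fun e => hij e.symm)]
      rw [hj0, add_zero] at hi
      cases s <;> simp [stepVec] at hi
  · rintro rfl
    obtain ⟨i, s⟩ := a
    cases s <;> simp [stepVec]

/-- ★ MEMORY TWO ON THE WORD: the trace of `w` has memory `2` iff `w` has no immediate reversal (no letter followed by its opposite).
[cite: MadrasSlade1993, §1.2 (p. 10: memory 2 rules out immediate reversals); lane lemma] -/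
theorem isMemory_two_wordPos_iff (w : Fin n → Fin d × Bool) :
    IsMemory 2 n (wordPos w) ↔ ∀ p : Fin n, ∀ hp : p.val + 1 < n, w ⟨p.val + 1, hp⟩ ≠ ((w p).1, !(w p).2) := by
  constructor
  · intro hmem p hp hrev
    apply hmem p.val (p.val + 2) (by omega) (by omega) (by omega)
    rw [wordPos_succ w hp, wordPos_succ w p.2, add_assoc, show (⟨p.val, p.2⟩ : Fin n) = p from rfl, hrev,
      (stepVec_add_eq_zero_iff_eq_rev (w p) _).2 rfl, add_zero]
  · intro h i j hj hij hji heq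
    -- `j = i + 1` is impossible (a unit step is non-zero), `j = i + 2` is a reversal
    rcases (by omega : j = i + 1 ∨ j = i + 2) with rfl | rfl
    · rw [wordPos_succ w (by omega : i < n)] at heq
      have h0 : stepVec (w ⟨i, by omega⟩) = 0 := by
        have := heq.symm
        rwa [add_eq_left] at this
      have hne : stepVec (w ⟨i, by omega⟩) ≠ 0 := by
        obtain ⟨a, b⟩ := w ⟨i, by omega⟩
        intro hz
        have := congrFun hz a
        cases b <;> simp [stepVec] at this
      exact hne h0
    · rw [wordPos_succ w (by omega : i + 1 < n), wordPos_succ w (by omega : i < n), add_assoc] at heq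
      have h0 : stepVec (w ⟨i, by omega⟩) + stepVec (w ⟨i + 1, by omega⟩) = 0 := by
        have := heq.symm
        rwa [add_eq_left] at this
      exact h ⟨i, by omega⟩ (by simpa using (show i + 1 < n by omega)) ((stepVec_add_eq_zero_iff_eq_rev _ _).1 h0)

/-- Before the first step on axis `a` the `a`-coordinate of the trace vanishes; a non-zero coordinate was stepped on.
[cite: MadrasSlade1993, §1.1 (p. 1); lane plumbing] -/
private theorem wb_wordPos_apply_eq_zero (w : Fin n → Fin d × Bool) (a : Fin d) {k : ℕ}
    (hk : ∀ p : Fin n, p.val < k → (w p).1 ≠ a) : wordPos w k a = 0 := by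
  induction k with
  | zero => rw [wordPos_zero]; rfl
  | succ k ih =>
    by_cases hkn : k < n
    · rw [wordPos_succ w hkn, Pi.add_apply, ih (fun p hp => hk p (by omega))]
      have hne : (w ⟨k, hkn⟩).1 ≠ a := hk ⟨k, hkn⟩ (by simp)
      rcases hws : w ⟨k, hkn⟩ with ⟨b, s⟩
      rw [hws] at hne
      cases s <;> simp [stepVec, Pi.single_eq_of_ne (Ne.symm hne)]
    · rw [wordPos_of_le w (by omega : n ≤ k + 1), ← wordPos_of_le w (by omega : n ≤ k), ih (fun p hp => hk p (by omega))]

/-- ★ ALL AXES ON THE WORD: the trace of `w` steps on every axis of `ℤ^d` iff every axis occurs as a letter of `w`.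
[cite: MadrasSlade1993, §1.1 eq. (1.1.8) p. 5; lane lemma] -/
theorem allAxes_wordPos_iff (w : Fin n → Fin d × Bool) :
    (∀ a : Fin d, ∃ i ≤ n, wordPos w i a ≠ (0 : ℤ)) ↔ ∀ a : Fin d, ∃ p : Fin n, (w p).1 = a := by
  constructor
  · intro h a
    obtain ⟨i, -, hi⟩ := h a
    by_contra hno
    exact hi (wb_wordPos_apply_eq_zero w a fun p _ h' => hno ⟨p, h'⟩)
  · intro h a
    classical
    -- the first occurrence of the axis
    obtain ⟨p, hp⟩ := h a
    let S := Finset.univ.filter fun q : Fin n => (w q).1 = a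
    have hS : S.Nonempty := ⟨p, by simp [S, hp]⟩
    set q := S.min' hS with hq
    have hqS : (w q).1 = a := by
      have := Finset.min'_mem S hS
      rw [← hq] at this
      simpa [S] using this
    have hbefore : ∀ r : Fin n, r.val < q.val → (w r).1 ≠ a := by
      intro r hr hra
      have : q ≤ r := by
        rw [hq]; exact Finset.min'_le S r (by simp [S, hra])
      exact absurd hr (by simpa using this)
    refine ⟨q.val + 1, by omega, ?_⟩
    rw [wordPos_succ w q.2, Pi.add_apply, show (⟨q.val, q.2⟩ : Fin n) = q from rfl, wb_wordPos_apply_eq_zero w a hbefore, zero_add]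
    rcases hw : w q with ⟨b, s⟩
    have hb : b = a := by simpa [hw] using hqS
    subst hb
    cases s <;> simp [stepVec]

open Classical in
/-- ★★ THE BAD-WALK CLASSES AS WORD COUNTS: `G_n(u)` — the non-self-avoiding memory-2 walks of length `n` on `ℤ^u` that step on every axis
(the inline class of `SAWCountZdTopCoefficients.memCount_two_eq_count_add_sum_choose`) — equals the number of step words
`w ∈ ({1…u} × {±})ⁿ` with (i) no immediate reversal, (ii) two equal partial sums `wordPos w i = wordPos w j` (`i < j ≤ n`), (iii) every axis
occurring. (The word-level form on which the lane's type calculus `WordTypes.canon` / `card_filter_sameType` acts: the count is `u!` times the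
number of canonical such words; lane DESIGN-ZD-CENSUS-LAW-L1 §3b.) [cite: MadrasSlade1993, §1.1 eq. (1.1.8) p. 5; §1.2 (p. 10); lane theorem] -/
theorem card_badClass_eq_card_badWords (u n : ℕ) :
    ((memWalks u 2 n).filter fun (ω : ℕ → Site u) =>
        (∃ i ≤ n, ∃ j ≤ n, i < j ∧ ω i = ω j) ∧ ∀ a : Fin u, ∃ i ≤ n, ω i a ≠ (0 : ℤ)).card =
      (Finset.univ.filter fun w : Fin n → Fin u × Bool =>
        (∀ p : Fin n, ∀ hp : p.val + 1 < n, w ⟨p.val + 1, hp⟩ ≠ ((w p).1, !(w p).2)) ∧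
        (∃ i ≤ n, ∃ j ≤ n, i < j ∧ wordPos w i = wordPos w j) ∧ ∀ a : Fin u, ∃ p : Fin n, (w p).1 = a).card := by
  classical
  rw [card_filter_memWalks_eq_card_filter_words]
  exact congrArg Finset.card (Finset.filter_congr fun w _ => by rw [isMemory_two_wordPos_iff, allAxes_wordPos_iff])

end WordBridge

end Literature.Probability.RandomPlanarGeometry.SAW.Zd
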